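import Summits.CriticalPhenomena.PercolationContinuityZ3.Theorems.FK.InfiniteVolumeDLRClusters
import Literature.Probability.LatticeModels.RandomClusterFKG
import HarnessLib

/-!
# FK-continuity transplant, FO-06/FO-10 (infinite-volume structure): the boundary condition induced by an outside
# configuration as a FINITE graph on the region — the join lemma for the specification kernel `φ^ξ_{Λ,p,q}`

Registered R80 (cell INBOX l.5895, 2026-08-23); registry row FO-10b-g407k; label KCM-A (coordinator fk-4 g175).
Cell `fk-continuity` (bschramm), FO-10b lineage; support file for the FK-continuity transplant
(`--supports stmt-CriticalPhenomena-4575`); builds on p205010 (kernel theorem, internal audit signed; external expert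
review pending). No named facts, no definitions, no sorries, standard axioms. Banked infinite-volume structure; not an
END-STATE dependency of the cell (not consumed by `_r3`); it says nothing about FH / TP_FK or continuity at `p_c`.

Grimmett 2006, §4.2 (4.12) / Lemma (4.13): the kernel `φ^ξ_{Λ,p,q}` weights an inside pattern `η ⊆ E_Λ` by
`q^{k(η ∪ (ξ ∖ E_Λ), Λ)}`, the number of clusters of the glued configuration meeting `Λ`.  Here this count is
identified with the number of connected components of a finite graph on `↥Λ`:

* the **join graph** of `η` and `ζ` on `Λ` is the graph `(openGraph η).comap val ⊔ (fromRel (openGraph ζ).Reachable).comap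
  val` on `↥Λ` — the inside edges `η` together with the pairs of `Λ` joined by `ζ`-open paths (no new definition:
  `SimpleGraph.fromRel (openGraph ζ).Reachable` is the `ζ`-connection graph, `fromRel_reachable_adj`; `join_adj`);
* `reachable_union_iff_join` — **join lemma**: for `η` inside `Λ` and any `ζ`, two vertices of `Λ` are joined in
  `η ∪ ζ` iff they are joined in the join graph (walk induction: a path alternates inside edges and outside excursions,
  and every excursion starts and ends in `Λ`);
* `meetClusterCount_union_eq_card_join`, `rcCondWeight_eq_pow_card_comap` — `k(η ∪ ζ, Λ) = #components of the join
  graph`, so the kernel weight is a random-cluster weight on `(Λ, E_Λ)` with the boundary-condition GRAPH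
  `R_ξ = (fromRel (openGraph (ξ ∖ E_Λ)).Reachable).comap val`;
* `card_connectedComponent_add_sup_le`, `card_connectedComponent_sup_sub_mono`,
  `card_connectedComponent_openGraph_sup_supermodular` — the merges contributed by a fixed extra graph are antitone
  and the cluster count with an extra graph is supermodular (tree `card_connectedComponent_supermodular`).

## References

* G. Grimmett, *The Random-Cluster Model*, Springer 2006: §4.2 (4.11)–(4.13), Lemma (4.13), Lemma (4.14)(b),
  Thm. (3.8) eq. (3.12). [Grimmett2006]
-/

noncomputable section

open MeasureTheory Set Filter

namespace Summit.CriticalPhenomena.PercolationContinuityZ3.Theorems.FK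

open Literature.Probability.Percolation Literature.Probability.LatticeModels

variable {V : Type*}

/-- Adjacency in the `ζ`-connection graph `fromRel (openGraph ζ).Reachable`: `u ~ v` iff `u ≠ v` are joined by a
`ζ`-open path. [folklore] -/
theorem fromRel_reachable_adj {ζ : BondConfig V} {u v : V} :
    (SimpleGraph.fromRel (openGraph ζ).Reachable).Adj u v ↔ u ≠ v ∧ (openGraph ζ).Reachable u v := by
  rw [SimpleGraph.fromRel_adj]
  exact and_congr_right fun _ => ⟨fun h => h.elim id SimpleGraph.Reachable.symm, Or.inl⟩

/-- Adjacency in the join graph of `η` and `ζ` on `Λ`: an `η`-edge or a `ζ`-connection between two distinct vertices of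
`Λ`. [folklore] -/
theorem join_adj {Λ : Set V} {η ζ : BondConfig V} {a b : Λ} :
    ((openGraph η).comap (Subtype.val : Λ → V) ⊔
        (SimpleGraph.fromRel (openGraph ζ).Reachable).comap (Subtype.val : Λ → V)).Adj a b ↔
      a ≠ b ∧ (s((a : V), (b : V)) ∈ η ∨ (openGraph ζ).Reachable a b) := by
  rw [SimpleGraph.sup_adj, SimpleGraph.comap_adj, SimpleGraph.comap_adj, openGraph_adj, fromRel_reachable_adj]
  have : (a : V) ≠ b ↔ a ≠ b := Subtype.coe_injective.ne_iff
  constructor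
  · rintro (⟨h, hne⟩ | ⟨hne, h⟩)
    · exact ⟨this.1 hne, Or.inl h⟩
    · exact ⟨this.1 hne, Or.inr h⟩
  · rintro ⟨hne, h | h⟩
    · exact Or.inl ⟨h, this.2 hne⟩
    · exact Or.inr ⟨this.2 hne, h⟩

/-- Two vertices of `Λ` joined by `ζ` are equal or adjacent in the join graph. [folklore] -/
theorem join_reachable_of_reachable {Λ : Set V} (η : BondConfig V) {ζ : BondConfig V} {a b : V} (ha : a ∈ Λ)
    (hb : b ∈ Λ) (h : (openGraph ζ).Reachable a b) :
    ((openGraph η).comap (Subtype.val : Λ → V) ⊔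
        (SimpleGraph.fromRel (openGraph ζ).Reachable).comap (Subtype.val : Λ → V)).Reachable ⟨a, ha⟩ ⟨b, hb⟩ := by
  by_cases hab : a = b
  · subst hab; exact SimpleGraph.Reachable.refl _
  · exact SimpleGraph.Adj.reachable (join_adj.2 ⟨fun h' => hab (congrArg Subtype.val h'), Or.inr h⟩)

/-- **Join lemma**: for `η` made of pairs inside `Λ` and any `ζ`, two vertices of `Λ` are joined in `η ∪ ζ` iff they
are joined in the join graph of `η` and `ζ` on `Λ`. [folklore] -/
theorem reachable_union_iff_join {Λ : Set V} {η ζ : BondConfig V} (hη : ∀ e ∈ η, ∀ v ∈ e, v ∈ Λ)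
    {a b : V} (ha : a ∈ Λ) (hb : b ∈ Λ) :
    (openGraph (η ∪ ζ)).Reachable a b ↔
      ((openGraph η).comap (Subtype.val : Λ → V) ⊔
        (SimpleGraph.fromRel (openGraph ζ).Reachable).comap (Subtype.val : Λ → V)).Reachable ⟨a, ha⟩ ⟨b, hb⟩ := by
  classical
  set J := (openGraph η).comap (Subtype.val : Λ → V) ⊔
    (SimpleGraph.fromRel (openGraph ζ).Reachable).comap (Subtype.val : Λ → V) with hJ
  constructor
  · intro h
    obtain ⟨w⟩ := h
    -- invariant along a walk `u → v` (`v ∈ Λ`): `u` is `ζ`-joined to some `c ∈ Λ` that is join-reachable from `v`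
    suffices key : ∀ {u v : V} (w : (openGraph (η ∪ ζ)).Walk u v) (hv : v ∈ Λ),
        ∃ c, ∃ hc : c ∈ Λ, (openGraph ζ).Reachable u c ∧ J.Reachable ⟨c, hc⟩ ⟨v, hv⟩ by
      obtain ⟨c, hc, h1, h2⟩ := key w hb
      exact (join_reachable_of_reachable η ha hc h1).trans h2
    intro u v w
    induction w with
    | nil => exact fun hv => ⟨_, hv, SimpleGraph.Reachable.refl _, SimpleGraph.Reachable.refl _⟩
    | @cons u x v hux _ ih =>
      intro hv
      obtain ⟨c, hc, hxc, hcv⟩ := ih hv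
      rw [openGraph_adj, Set.mem_union] at hux
      rcases hux with ⟨hmem | hmem, hne⟩
      · -- an inside edge: both end points lie in `Λ`
        have hu : u ∈ Λ := hη _ hmem u (Sym2.mem_mk_left u x)
        have hx : x ∈ Λ := hη _ hmem x (Sym2.mem_mk_right u x)
        refine ⟨u, hu, SimpleGraph.Reachable.refl _, ?_⟩
        have h1 : J.Adj ⟨u, hu⟩ ⟨x, hx⟩ :=
          join_adj.2 ⟨fun h' => hne (congrArg Subtype.val h'), Or.inl hmem⟩
        exact h1.reachable.trans ((join_reachable_of_reachable η hx hc hxc).trans hcv)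
      · -- an outside edge: `u` is `ζ`-joined to `x`, hence to `c`
        have h1 : (openGraph ζ).Adj u x := (openGraph_adj ζ u x).2 ⟨hmem, hne⟩
        exact ⟨c, hc, h1.reachable.trans hxc, hcv⟩
  · intro h
    -- every join-graph step is an `η ∪ ζ`-connection
    have hmono : ∀ {x y : Λ}, J.Adj x y → (openGraph (η ∪ ζ)).Reachable (x : V) (y : V) := by
      intro x y hxy
      rcases join_adj.1 hxy with ⟨hne, hxy | hxy⟩
      · refine SimpleGraph.Adj.reachable ((openGraph_adj _ _ _).2 ⟨Set.mem_union_left _ hxy, ?_⟩)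
        exact fun h' => hne (Subtype.ext h')
      · exact hxy.mono (by
          intro u v huv
          rw [openGraph_adj] at huv ⊢
          exact ⟨Set.mem_union_right _ huv.1, huv.2⟩)
    suffices key : ∀ {x y : Λ}, J.Reachable x y → (openGraph (η ∪ ζ)).Reachable (x : V) (y : V) from
      key h
    intro x y hxy
    obtain ⟨w⟩ := hxy
    induction w with
    | nil => exact SimpleGraph.Reachable.refl _
    | cons hxy _ ih => exact (hmono hxy).trans ih

/-- **The kernel's cluster count is a finite-graph component count**: `k(η ∪ ζ, Λ)` = the number of connected
components of the join graph of `η` and `ζ` on `Λ`. [folklore] -/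
theorem meetClusterCount_union_eq_card_join {Λ : Set V} {η ζ : BondConfig V}
    (hη : ∀ e ∈ η, ∀ v ∈ e, v ∈ Λ) :
    meetClusterCount (η ∪ ζ) Λ = Nat.card ((openGraph η).comap (Subtype.val : Λ → V) ⊔
      (SimpleGraph.fromRel (openGraph ζ).Reachable).comap (Subtype.val : Λ → V)).ConnectedComponent := by
  classical
  rw [meetClusterCount_eq]
  set J := (openGraph η).comap (Subtype.val : Λ → V) ⊔
    (SimpleGraph.fromRel (openGraph ζ).Reachable).comap (Subtype.val : Λ → V) with hJ
  -- classes of `Λ` under `η ∪ ζ`-connection ↔ components of the join graph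
  have h1 := ncard_image_eq_of_forall_iff (openGraph (η ∪ ζ)).connectedComponentMk
    (fun u : V => if hu : u ∈ Λ then some (J.connectedComponentMk ⟨u, hu⟩) else none) Λ
    fun u hu v hv => by
      rw [dif_pos hu, dif_pos hv, Option.some_inj, SimpleGraph.ConnectedComponent.eq,
        SimpleGraph.ConnectedComponent.eq]
      exact reachable_union_iff_join hη hu hv
  have hg : (fun u : V => if hu : u ∈ Λ then some (J.connectedComponentMk ⟨u, hu⟩) else none) '' Λ =
      some '' Set.univ := by
    ext o
    constructor
    · rintro ⟨u, hu, rfl⟩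
      exact ⟨J.connectedComponentMk ⟨u, hu⟩, Set.mem_univ _, by simp only [dif_pos hu]⟩
    · rintro ⟨c, -, rfl⟩
      induction c using SimpleGraph.ConnectedComponent.ind with
      | h a => exact ⟨a, a.2, by simp only [dif_pos a.2]⟩
  rw [h1, hg, Set.ncard_image_of_injective _ (Option.some_injective _), Set.ncard_univ]


/-! ### The merges contributed by a fixed extra graph are antitone in the base graph -/

section Tilt

variable {W : Type*} [Finite W]

/-- For graphs `G ≤ G'` on a finite vertex set and a fixed graph `R`: `k(G') + k(G ⊔ R) ≤ k(G) + k(G' ⊔ R)`, i.e.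
`k(G) - k(G ⊔ R)` (the number of merges contributed by `R`) is antitone in `G` — supermodularity of the number of
components (Grimmett 2006, (3.12)). [cite: Grimmett2006, Thm. 3.8, eq. (3.12)] -/
theorem card_connectedComponent_add_sup_le (R : SimpleGraph W) {G G' : SimpleGraph W} (h : G ≤ G') :
    Nat.card G'.ConnectedComponent + Nat.card (G ⊔ R).ConnectedComponent ≤
      Nat.card G.ConnectedComponent + Nat.card (G' ⊔ R).ConnectedComponent := by
  have h1 := card_connectedComponent_supermodular G' (G ⊔ R)
  have h2 : G' ⊔ (G ⊔ R) = G' ⊔ R := by rw [← sup_assoc, sup_eq_left.2 h]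
  have h3 : Nat.card (G' ⊓ (G ⊔ R)).ConnectedComponent ≤ Nat.card G.ConnectedComponent :=
    SimpleGraph.ConnectedComponent.card_le_card_of_le (le_inf h le_sup_left)
  rw [h2] at h1
  omega

/-- The same read as monotonicity of the tilt exponent: for `G ≤ G'`,
`k(G ⊔ R) - k(G) ≤ k(G' ⊔ R) - k(G')` in `ℤ`. [cite: Grimmett2006, Thm. 3.8, eq. (3.12)] -/
theorem card_connectedComponent_sup_sub_mono (R : SimpleGraph W) {G G' : SimpleGraph W} (h : G ≤ G') :
    (Nat.card (G ⊔ R).ConnectedComponent : ℤ) - Nat.card G.ConnectedComponent ≤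
      (Nat.card (G' ⊔ R).ConnectedComponent : ℤ) - Nat.card G'.ConnectedComponent := by
  have := card_connectedComponent_add_sup_le R h
  omega


/-- **Supermodularity of the number of clusters with an arbitrary extra graph `R` glued in** (the graph lattice is
distributive): `k(ω₁ ⊔ R) + k(ω₂ ⊔ R) ≤ k((ω₁ ∩ ω₂) ⊔ R) + k((ω₁ ∪ ω₂) ⊔ R)` — the FKG lattice condition for the
random-cluster weights with a general boundary condition `R` (Grimmett 2006, (3.12); `R = wired B` is the tree's
`clusterCount_supermodular`). [cite: Grimmett2006, Thm. 3.8, eq. (3.12)] -/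
theorem card_connectedComponent_openGraph_sup_supermodular (R : SimpleGraph W) (ω₁ ω₂ : BondConfig W) :
    Nat.card (openGraph ω₁ ⊔ R).ConnectedComponent + Nat.card (openGraph ω₂ ⊔ R).ConnectedComponent ≤
      Nat.card (openGraph (ω₁ ∩ ω₂) ⊔ R).ConnectedComponent +
        Nat.card (openGraph (ω₁ ∪ ω₂) ⊔ R).ConnectedComponent := by
  unfold openGraph
  have hinf : SimpleGraph.fromEdgeSet (ω₁ ∩ ω₂) ⊔ R =
      (SimpleGraph.fromEdgeSet ω₁ ⊔ R) ⊓ (SimpleGraph.fromEdgeSet ω₂ ⊔ R) := by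
    rw [SimpleGraph.fromEdgeSet_inter, sup_inf_right]
  have hsup : SimpleGraph.fromEdgeSet (ω₁ ∪ ω₂) ⊔ R =
      (SimpleGraph.fromEdgeSet ω₁ ⊔ R) ⊔ (SimpleGraph.fromEdgeSet ω₂ ⊔ R) := by
    rw [SimpleGraph.fromEdgeSet_union, sup_sup_distrib_right]
  rw [hinf, hsup]
  exact card_connectedComponent_supermodular _ _

end Tilt



/-! ### The specification kernel's cluster count through the join graph -/

section KernelJoin

variable {d : ℕ}

/-- For an inside pattern `η ⊆ E_Λ`, every edge of `η` has both end points in `Λ`. [folklore] -/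
theorem forall_mem_of_subset_edgesIn {Λ : Finset (Site d)} {η : Finset (Sym2 (Site d))}
    (hη : η ⊆ edgesIn (zdGraph d) Λ) : ∀ e ∈ (↑η : Set (Sym2 (Site d))), ∀ v ∈ e, v ∈ (↑Λ : Set (Site d)) :=
  fun _ he v hv => Finset.mem_coe.2 ((mem_edgesIn_iff.1 (hη (Finset.mem_coe.1 he))).2 v hv)

/-- **The kernel weight as a pulled-back random-cluster weight with boundary-condition graph**:
`w^ξ_Λ(η) = p^{|η|}(1-p)^{|E_Λ ∖ η|} q^{k(η)}` with `k(η) = #components of the join graph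
((openGraph η).comap val ⊔ (fromRel (openGraph (ξ ∖ E_Λ)).Reachable).comap val)` on the finite type `↥Λ` — the
specification kernel of `InfiniteVolumeDLRDefs` is a random-cluster weight on the FINITE graph `(Λ, E_Λ)` with the
boundary-condition graph induced by `ξ`. [cite: Grimmett2006, §4.2 (4.12), Lemma (4.13)] -/
theorem rcCondWeight_eq_pow_card_comap (p q : ℝ) (Λ : Finset (Site d)) (ξ : BondConfig (Site d))
    {η : Finset (Sym2 (Site d))} (hη : η ⊆ edgesIn (zdGraph d) Λ) :
    rcCondWeight p q Λ ξ η = p ^ η.card * (1 - p) ^ (edgesIn (zdGraph d) Λ \ η).card *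
      q ^ Nat.card ((openGraph (↑η : BondConfig (Site d))).comap (Subtype.val : (↑Λ : Set (Site d)) → Site d) ⊔
        (SimpleGraph.fromRel (openGraph (ξ \ ↑(edgesIn (zdGraph d) Λ))).Reachable).comap
          (Subtype.val : (↑Λ : Set (Site d)) → Site d)).ConnectedComponent := by
  rw [rcCondWeight_eq, meetClusterCount_union_eq_card_join (forall_mem_of_subset_edgesIn hη)]

end KernelJoin

end Summit.CriticalPhenomena.PercolationContinuityZ3.Theorems.FK

end
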